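import Summits.ValiantsHypothesis.ValiantsHypothesis.Theorems.KPlusLogSqLawTropicalBTwoRowSymmetric

/-!
# Route «KPlusLogSqLaw» — the SYMMETRIC `(3,4)` tropical row: a symmetric `3 × 3` four-class dominance design has at most
# `18` sign-alternating dominant breakpoints, ON EVERY SUPPORT (`T_sym(3,4) ≤ 18 ∀ d`)

HONEST FRAMING.  Helper file (seat val-sym-lift-p2 (g4), cell `pub-symmetroid`, 2026-08-26; `--supports` the `WeakLifting` item
stmt-ValiantsHypothesis-19561 as a helper, no closure claim).  A SMALL-FORMAT, ORDER-LEVEL statement far inside the known regime of the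
cruxes; nothing here is about `TropicalB` / `WeakLifting` in their windows, Conjecture B, the real census numeral of Door A at `(3,4)`
(`PosRootLawAt 3 4 18`, OPEN, never asserted — a tropical ceiling constrains Viro-type constructions only, not real pencils),
`MatrixDescartes` (stmt-ValiantsHypothesis-18050) or VP ≠ VNP.

STATEMENT (`tropRow_three_four_symm_le`, over an explicit chain as in `tropRow_two_symm_le`; the tree has no symmetric-row predicate):
for exponents `d : Fin 4 → ℕ` (ANY support, injective or not), SYMMETRIC valuations and signs `v ε : Fin 3 → Fin 3 → Fin 4 → ℤ`, and a
chain of `n + 1` uniquely dominant terms at strictly increasing integer slopes with alternating signs, `n ≤ 18`.  The general `(3,4)`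
tropical row is `19`, counting-tight (`T(3,4) = 19`: all `20 = C(6,3)` class multisets CAN be dominant in alternating order for a
non-symmetric design — the cell's D2 row of record); symmetry costs exactly the all-`20` row.  Consequently symmetric patchworking at
the same format (`TropicalCensus.symmDesign_le_of_posRootLawAt`) can never produce more than the census value `18` positive zeros at
`(3,4)`: the tropical side of Door A at `(3,4)` cannot be refuted by a symmetric Viro design, on any support.  (The cell's z3 searches
had the all-`20` symmetric row UNSAT on five supports; this file is the `∀ d` statement at the `≤ 18` level.  The sharper «`≤ 17 ∀ d`»
does NOT follow at order level — 19-vertex order patterns survive the constraints used here.)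

PROOF (order level; tree lemmas + one pigeonhole).
* A uniquely dominant term of a symmetric design is an involution with a cycle-constant class map
  (`TropicalCensus.isDominant_symm_involutive`): in `S₃` it is the identity with a class vector `(λ₀, λ₁, λ₂)`, or a transposition
  `(i j)` with ONE class `a` on the pair and a class `b` on the fixed point.
* Slopes strictly increase along the chain (`TropicalCensus.slope_lt_of_dominant`), so the class multisets of the chain terms are
  pairwise distinct; there are `multichoose 4 3 = 20` of them, so `n + 1 ≤ 20`, and `n = 19` forces EVERY multiset to occur.
* Terms with the SAME permutation have entrywise non-decreasing exponents along the chain (`TropicalCensus.d_lt_of_dominant`).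
* Relabel classes by exponent rank (`dRank`; no injectivity of `d` is needed: equal ranks have equal exponents, `d_eq_of_dRank_eq`, so
  the rank multisets of the chain terms are still pairwise distinct).  If all `20` rank multisets occurred: at class-sum `r = j + 3`
  (`j = 0,1,2,3`) the distinct-class multiset `{0,1,2} / {0,1,3} / {0,2,3} / {1,2,3}` is served by an identity term (a cycle-constant
  non-identity term repeats a class), hence the multiset `{j, j, 3−j}` of the same class-sum is NOT (two identity terms are entrywise
  comparable, and comparable vectors with equal sums are equal) — it is served by a transposition with pair class `a = j` and fixed
  class `b = 3 − j`.  Four such terms, three transpositions: two share a transposition, so their class vectors are entrywise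
  comparable — but `a` increases exactly when `b` decreases.  Contradiction; hence `n ≤ 18`.
[cell statement (HOME/INBOX R1530); folklore-level counting proof, no citation exists]
-/

set_option linter.dupNamespace false
set_option autoImplicit false

namespace Summit.ValiantsHypothesis.ValiantsHypothesis.Theorems.KPlusLogSqLaw

open Summit.ValiantsHypothesis.ValiantsHypothesis.Theorems.MatrixDescartes.Negative
open Summit.ValiantsHypothesis.ValiantsHypothesis.Theorems.LacunarySymmetroidMatrixDescartes
open Summit.ValiantsHypothesis.ValiantsHypothesis.Theorems.LacunarySymmetroidMatrixDescartes.TropicalCensus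
open Finset

namespace SymmetricThreeFour

/-! ## 1. Class multisets: counts and class sums -/

/-- the multiplicity of a class in the class multiset of a term is the number of entries carrying that class. [folklore] -/
theorem count_classSym {m K : ℕ} (q : Equiv.Perm (Fin m) × (Fin m → Fin K)) (l : Fin K) :
    Multiset.count l (TropicalCensus.classSym q : Multiset (Fin K)) = (univ.filter fun i => q.2 i = l).card := by
  unfold TropicalCensus.classSym
  simp only [Sym.coe_mk]
  rw [Multiset.count_map, Finset.card_def, Finset.filter_val]
  congr 1
  exact Multiset.filter_congr fun i _ => eq_comm

/-- equal class multisets have equal class counts. [folklore] -/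
theorem card_filter_eq_of_classSym_eq {m K : ℕ} {q q' : Equiv.Perm (Fin m) × (Fin m → Fin K)}
    (h : TropicalCensus.classSym q = TropicalCensus.classSym q') (l : Fin K) :
    (univ.filter fun i => q.2 i = l).card = (univ.filter fun i => q'.2 i = l).card := by
  rw [← count_classSym, ← count_classSym, h]

/-- equal class multisets have equal class sums. [folklore] -/
theorem sum_val_eq_of_classSym_eq {m K : ℕ} {q q' : Equiv.Perm (Fin m) × (Fin m → Fin K)}
    (h : TropicalCensus.classSym q = TropicalCensus.classSym q') :
    ∑ i, ((q.2 i : Fin K) : ℕ) = ∑ i, ((q'.2 i : Fin K) : ℕ) := by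
  have key : ∀ q : Equiv.Perm (Fin m) × (Fin m → Fin K),
      ∑ i, ((q.2 i : Fin K) : ℕ) = ((TropicalCensus.classSym q : Multiset (Fin K)).map fun l : Fin K => (l : ℕ)).sum := by
    intro q
    unfold TropicalCensus.classSym
    simp only [Sym.coe_mk, Multiset.map_map]
    rfl
  rw [key, key, h]

/-! ## 2. Cycle-constant terms of `S₃ × (Fin 3 → Fin 4)` read off their class counts -/

/-- in `Fin 3`, two elements avoiding the same two distinct elements coincide. -/
theorem fin3_third (i j x y : Fin 3) (h1 : j ≠ i) (h2 : x ≠ i) (h3 : x ≠ j) (h4 : y ≠ i) (h5 : y ≠ j) : x = y := by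
  simp only [ne_eq, Fin.ext_iff] at *
  omega

/-- the non-identity permutations of `Fin 3` with a fixed point are the three transpositions. -/
theorem perm_three_of_fixed : ∀ σ : Equiv.Perm (Fin 3), σ ≠ 1 → (∃ k, σ k = k) →
    σ = Equiv.swap 0 1 ∨ σ = Equiv.swap 0 2 ∨ σ = Equiv.swap 1 2 := by decide

/-- two entries with the same class give that class a count `≥ 2`. -/
theorem two_le_card_filter (q : Equiv.Perm (Fin 3) × (Fin 3 → Fin 4)) {i j : Fin 3} (hij : j ≠ i)
    (h : q.2 j = q.2 i) : 2 ≤ (univ.filter fun x => q.2 x = q.2 i).card := by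
  have hsub : ({j, i} : Finset (Fin 3)) ⊆ univ.filter fun x => q.2 x = q.2 i := by
    intro x hx
    rw [mem_insert, mem_singleton] at hx
    rw [mem_filter]
    rcases hx with rfl | rfl
    · exact ⟨mem_univ _, h⟩
    · exact ⟨mem_univ _, rfl⟩
  calc 2 = ({j, i} : Finset (Fin 3)).card := (card_pair hij).symm
    _ ≤ _ := card_le_card hsub

/-- a cycle-constant term (`λ ∘ σ = λ`) whose classes have counts `≤ 1` is an identity term. [folklore] -/
theorem perm_eq_one_of_card_le_one (q : Equiv.Perm (Fin 3) × (Fin 3 → Fin 4))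
    (hc : ∀ i, q.2 (q.1 i) = q.2 i) (hle : ∀ l, (univ.filter fun i => q.2 i = l).card ≤ 1) : q.1 = 1 := by
  by_contra hne
  obtain ⟨i, hi⟩ : ∃ i, q.1 i ≠ i := not_forall.mp fun h => hne (Equiv.ext h)
  have h2 := two_le_card_filter q hi (hc i)
  have h1 := hle (q.2 i)
  omega

/-- a cycle-constant NON-identity term with class count `1` at `b` and `≤ 1` away from `a`: the moved entries carry `a`, every
fixed entry carries `b`, and a fixed entry exists (so the permutation is the transposition of the two `a`-entries). [folklore] -/
theorem transposition_served (q : Equiv.Perm (Fin 3) × (Fin 3 → Fin 4)) (a b : Fin 4)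
    (hc : ∀ i, q.2 (q.1 i) = q.2 i) (hne : q.1 ≠ 1)
    (hb : (univ.filter fun i => q.2 i = b).card = 1)
    (hle : ∀ l, l ≠ a → (univ.filter fun i => q.2 i = l).card ≤ 1) :
    (∀ i, q.1 i ≠ i → q.2 i = a) ∧ (∀ k, q.1 k = k → q.2 k = b) ∧ (∃ k, q.1 k = k) := by
  -- moved entries carry `a`
  have hmoved : ∀ i, q.1 i ≠ i → q.2 i = a := by
    intro i hi
    by_contra hia
    have h2 := two_le_card_filter q hi (hc i)
    have h1 := hle (q.2 i) hia
    omega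
  obtain ⟨i₀, hi₀⟩ : ∃ i, q.1 i ≠ i := not_forall.mp fun h => hne (Equiv.ext h)
  -- some entry carries `b`
  obtain ⟨k, hk⟩ : ∃ k, q.2 k = b := by
    have hpos : 0 < (univ.filter fun i => q.2 i = b).card := by rw [hb]; exact Nat.one_pos
    obtain ⟨k, hk⟩ := card_pos.mp hpos
    exact ⟨k, (mem_filter.mp hk).2⟩
  -- `a ≠ b`: the two moved entries `i₀, σ i₀` carry `a`
  have hab : a ≠ b := by
    intro hab
    have h2 := two_le_card_filter q hi₀ (hc i₀)
    rw [hmoved i₀ hi₀, hab, hb] at h2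
    omega
  -- hence the `b`-entry is fixed
  have hkfix : q.1 k = k := by
    by_contra h
    exact hab ((hmoved k h).symm.trans hk)
  refine ⟨hmoved, fun k' hk' => ?_, ⟨k, hkfix⟩⟩
  -- a fixed entry `k'` is the fixed entry `k`: both avoid the two moved entries `i₀ ≠ σ i₀`
  have h1 : k' ≠ i₀ := by
    rintro rfl
    exact hi₀ hk'
  have h2 : k' ≠ q.1 i₀ := by
    intro h
    apply h1
    exact q.1.injective (hk'.trans h)
  have h3 : k ≠ i₀ := by
    rintro rfl
    exact hi₀ hkfix
  have h4 : k ≠ q.1 i₀ := by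
    intro h
    apply h3
    exact q.1.injective (hkfix.trans h)
  rw [fin3_third i₀ (q.1 i₀) k' k hi₀ h1 h2 h3 h4]
  exact hk

/-! ## 3. The order-level core: the twenty class multisets cannot all be served

The eight target multisets are indexed by `j : Fin 4` (class sum `j + 3` throughout): the identity-type target «all classes but
`3 − j`» is the class vector `Fin.succAbove (Fin.rev j) : Fin 3 → Fin 4` (`{0,1,2}, {0,1,3}, {0,2,3}, {1,2,3}`), the transposition-type
target «pair class `j`, fixed class `3 − j`» is the class vector `(3 − j, j, j)` (`{0,0,3}, {1,1,2}, {2,2,1}, {3,3,0}`). -/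

/-- identity-type targets have pairwise distinct classes. -/
theorem idPat_card_le : ∀ j l : Fin 4, (univ.filter fun i : Fin 3 => Fin.succAbove (Fin.rev j) i = l).card ≤ 1 := by decide

/-- class sum of the identity-type targets. -/
theorem sum_idPat : ∀ j : Fin 4, ∑ i : Fin 3, (Fin.succAbove (Fin.rev j) i : ℕ) = j + 3 := by decide

/-- the pair class of a transposition-type target has count `2`. -/
theorem trPat_card_a : ∀ j : Fin 4, (univ.filter fun i : Fin 3 => (if i = 0 then Fin.rev j else j) = j).card = 2 := by decide

/-- the fixed class of a transposition-type target has count `1`. -/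
theorem trPat_card_b : ∀ j : Fin 4,
    (univ.filter fun i : Fin 3 => (if i = 0 then Fin.rev j else j) = Fin.rev j).card = 1 := by decide

/-- away from the pair class, a transposition-type target has counts `≤ 1`. -/
theorem trPat_card_le : ∀ j l : Fin 4, l ≠ j →
    (univ.filter fun i : Fin 3 => (if i = 0 then Fin.rev j else j) = l).card ≤ 1 := by decide

/-- class sum of the transposition-type targets. -/
theorem sum_trPat : ∀ j : Fin 4, ∑ i : Fin 3, ((if i = 0 then Fin.rev j else j : Fin 4) : ℕ) = j + 3 := by decide

/-- `a = j` increases exactly when `b = 3 − j` decreases. -/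
theorem rev_anti : ∀ j j' : Fin 4, j ≤ j' → Fin.rev j ≤ Fin.rev j' → j = j' := by decide

/-- entrywise comparable class vectors with equal class sums are equal. -/
theorem eq_of_le_of_sum_eq (u w : Fin 3 → Fin 4) (hle : ∀ i, u i ≤ w i)
    (hs : ∑ i, (u i : ℕ) = ∑ i, (w i : ℕ)) : u = w := by
  have hle' : ∀ i ∈ (univ : Finset (Fin 3)), (u i : ℕ) ≤ (w i : ℕ) := fun i _ => Fin.le_iff_val_le_val.mp (hle i)
  have h := (Finset.sum_eq_sum_iff_of_le hle').mp hs
  funext i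
  exact Fin.ext (h i (mem_univ i))

/-- **ORDER-LEVEL CORE.**  Let `r₀, …, r_n` be terms of `S₃ × (Fin 3 → Fin 4)` with cycle-constant class maps, such that two terms
with the SAME permutation have entrywise non-decreasing classes along the sequence, and with pairwise distinct class multisets.  Then
`n ≤ 18` (the twenty multisets cannot all occur). [cell statement R1530; counting] -/
theorem core (n : ℕ) (r : Fin (n + 1) → Equiv.Perm (Fin 3) × (Fin 3 → Fin 4))
    (h1 : ∀ k i, (r k).2 ((r k).1 i) = (r k).2 i)
    (h2 : ∀ a b : Fin (n + 1), a < b → (r a).1 = (r b).1 → ∀ i, (r a).2 i ≤ (r b).2 i)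
    (h3 : Function.Injective fun k => TropicalCensus.classSym (r k)) : n ≤ 18 := by
  by_contra hn
  rw [not_le] at hn
  have hcard := Fintype.card_le_of_injective _ h3
  rw [Fintype.card_fin, Sym.card_sym_eq_multichoose, Fintype.card_fin] at hcard
  have h20 : Nat.multichoose 4 3 = 20 := by rw [Nat.multichoose_eq]; rfl
  obtain rfl : n = 19 := by omega
  have hsurj : ∀ M : Sym (Fin 4) 3, ∃ k : Fin (19 + 1), TropicalCensus.classSym (r k) = M := by
    have hbij : Function.Bijective fun k : Fin (19 + 1) => TropicalCensus.classSym (r k) := by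
      rw [Fintype.bijective_iff_injective_and_card]
      refine ⟨h3, ?_⟩
      rw [Fintype.card_fin, Sym.card_sym_eq_multichoose, Fintype.card_fin, h20]
    exact fun M => hbij.2 M
  -- comparability in either order
  have hcmp : ∀ a b : Fin (19 + 1), a ≠ b → (r a).1 = (r b).1 →
      (∀ i, (r a).2 i ≤ (r b).2 i) ∨ (∀ i, (r b).2 i ≤ (r a).2 i) := by
    intro a b hab hσ
    rcases lt_trichotomy a b with h | h | h
    · exact Or.inl (h2 a b h hσ)
    · exact absurd h hab
    · exact Or.inr (h2 b a h hσ.symm)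
  -- serve the eight patterns
  choose kI hkI using fun j : Fin 4 => hsurj (TropicalCensus.classSym ((1 : Equiv.Perm (Fin 3)), Fin.succAbove (Fin.rev j)))
  choose kT hkT using fun j : Fin 4 => hsurj (TropicalCensus.classSym ((1 : Equiv.Perm (Fin 3)), fun i : Fin 3 => if i = 0 then Fin.rev j else j))
  -- identity patterns are served by identity terms
  have hI1 : ∀ j, (r (kI j)).1 = 1 := fun j =>
    perm_eq_one_of_card_le_one _ (h1 _) fun l => by
      rw [card_filter_eq_of_classSym_eq (hkI j) l]
      exact idPat_card_le j l
  -- class sums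
  have hsumI : ∀ j, ∑ i, ((r (kI j)).2 i : ℕ) = j + 3 := fun j => by
    rw [sum_val_eq_of_classSym_eq (hkI j)]
    exact sum_idPat j
  have hsumT : ∀ j, ∑ i, ((r (kT j)).2 i : ℕ) = j + 3 := fun j => by
    rw [sum_val_eq_of_classSym_eq (hkT j)]
    exact sum_trPat j
  -- transposition patterns are served by NON-identity terms
  have hT1 : ∀ j, (r (kT j)).1 ≠ 1 := by
    intro j hj
    have hne : kI j ≠ kT j := by
      intro h
      have hA : (univ.filter fun i => (r (kI j)).2 i = j).card ≤ 1 := by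
        rw [card_filter_eq_of_classSym_eq (hkI j)]
        exact idPat_card_le j j
      have hB : (univ.filter fun i => (r (kT j)).2 i = j).card = 2 := by
        rw [card_filter_eq_of_classSym_eq (hkT j)]
        exact trPat_card_a j
      rw [h] at hA
      omega
    have hfst : (r (kI j)).1 = (r (kT j)).1 := by rw [hI1 j, hj]
    have heq : (r (kI j)).2 = (r (kT j)).2 := by
      rcases hcmp (kI j) (kT j) hne hfst with hle | hle
      · exact eq_of_le_of_sum_eq _ _ hle (by rw [hsumI, hsumT])
      · exact (eq_of_le_of_sum_eq _ _ hle (by rw [hsumI, hsumT])).symm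
    have hrr : r (kI j) = r (kT j) := Prod.ext hfst heq
    exact hne (h3 (by simp only [hrr]))
  -- structure of the transposition-served terms: moved entries carry `j`, fixed entries carry `3 − j`
  have hTs : ∀ j, (∀ i, (r (kT j)).1 i ≠ i → (r (kT j)).2 i = j) ∧
      (∀ k, (r (kT j)).1 k = k → (r (kT j)).2 k = Fin.rev j) ∧ (∃ k, (r (kT j)).1 k = k) := fun j =>
    transposition_served _ j (Fin.rev j) (h1 _) (hT1 j)
      (by rw [card_filter_eq_of_classSym_eq (hkT j)]; exact trPat_card_b j)
      (fun l hl => by rw [card_filter_eq_of_classSym_eq (hkT j)]; exact trPat_card_le j l hl)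
  -- pigeonhole: four transposition-served terms, three transpositions
  have hmem : ∀ j ∈ (univ : Finset (Fin 4)), (r (kT j)).1 ∈
      ({Equiv.swap 0 1, Equiv.swap 0 2, Equiv.swap 1 2} : Finset (Equiv.Perm (Fin 3))) := by
    intro j _
    obtain ⟨-, -, k, hk⟩ := hTs j
    have := perm_three_of_fixed _ (hT1 j) ⟨k, hk⟩
    simp only [mem_insert, mem_singleton]
    exact this
  have hlt : ({Equiv.swap 0 1, Equiv.swap 0 2, Equiv.swap 1 2} : Finset (Equiv.Perm (Fin 3))).card <
      (univ : Finset (Fin 4)).card := by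
    rw [card_univ, Fintype.card_fin]
    exact lt_of_le_of_lt Finset.card_le_three (by norm_num)
  obtain ⟨j, -, j', -, hjj', hσ⟩ := Finset.exists_ne_map_eq_of_card_lt_of_maps_to hlt hmem
  -- two of them share a transposition: their class vectors are comparable, but `a` rises exactly when `b` falls
  have hne : kT j ≠ kT j' := by
    intro h
    have h1' := hsumT j
    rw [h, hsumT j'] at h1'
    exact hjj' (Fin.ext (by omega)).symm
  have key : ∀ x y : Fin 4, (r (kT x)).1 = (r (kT y)).1 → (∀ i, (r (kT x)).2 i ≤ (r (kT y)).2 i) → x = y := by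
    intro x y hxy hle
    obtain ⟨hxa, hxb, k, hk⟩ := hTs x
    obtain ⟨hya, hyb, -⟩ := hTs y
    obtain ⟨i₀, hi₀⟩ : ∃ i, (r (kT x)).1 i ≠ i := not_forall.mp fun h => hT1 x (Equiv.ext h)
    have ha : x ≤ y := by
      have := hle i₀
      rw [hxa i₀ hi₀, hya i₀ (by rw [← hxy]; exact hi₀)] at this
      exact this
    have hb : Fin.rev x ≤ Fin.rev y := by
      have := hle k
      rw [hxb k hk, hyb k (by rw [← hxy]; exact hk)] at this
      exact this
    exact rev_anti x y ha hb
  rcases hcmp (kT j) (kT j') hne hσ with hle | hle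
  · exact hjj' (key j j' hσ hle)
  · exact hjj' (key j' j hσ.symm hle).symm

end SymmetricThreeFour

open SymmetricThreeFour

/-- **`T_sym(3,4) ≤ 18` ON EVERY SUPPORT.**  A SYMMETRIC `3 × 3` dominance design with four slope classes (symmetric valuations and
signs; any exponents `d`) has at most `18` sign-alternating uniquely dominant breakpoints along increasing integer slopes — one less
than the general `(3,4)` tropical row `T(3,4) = 19` (all twenty class multisets), which therefore needs asymmetry.  Consequence
(`TropicalCensus.symmDesign_le_of_posRootLawAt` read contrapositively): symmetric patchworking at format `(3,4)` never certifies more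
than the census value `18` positive zeros.  [cell statement R1530; folklore-level proof: `isDominant_symm_involutive`,
`slope_lt_of_dominant`, `d_lt_of_dominant`, `stub_dominantInjective` and the order-level core `SymmetricThreeFour.core`] -/
theorem tropRow_three_four_symm_le (d : Fin 4 → ℕ) (v ε : Fin 3 → Fin 3 → Fin 4 → ℤ)
    (hv : ∀ i j l, v i j l = v j i l) (hεs : ∀ i j l, ε i j l = ε j i l)
    (n : ℕ) (θ : Fin (n + 1) → ℤ) (p : Fin (n + 1) → Equiv.Perm (Fin 3) × (Fin 3 → Fin 4))
    (hθ : StrictMono θ) (hdom : ∀ k, IsDominant d v ε (θ k) (p k))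
    (halt : ∀ k : Fin n, termSign ε (p k.castSucc) * termSign ε (p k.succ) < 0) : n ≤ 18 := by
  have hinj : Function.Injective p := stub_dominantInjective 3 4 d v ε n θ p hθ hdom halt
  -- rank relabelling of the classes: `ρ l = dRank d l` as an element of `Fin 4`
  obtain ⟨ρ, hρ⟩ : ∃ ρ : Fin 4 → Fin 4, ∀ l, (ρ l : ℕ) = dRank d l :=
    ⟨fun l => ⟨dRank d l, lt_of_le_of_lt (dRank_le d l) (by norm_num)⟩, fun _ => rfl⟩
  have hρeq : ∀ {l l' : Fin 4}, ρ l = ρ l' → d l = d l' := fun {l l'} h =>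
    d_eq_of_dRank_eq d (by rw [← hρ, ← hρ, h])
  have hρle : ∀ {l l' : Fin 4}, d l < d l' → ρ l ≤ ρ l' := fun {l l'} h => by
    rw [Fin.le_iff_val_le_val, hρ, hρ]
    exact (dRank_lt_of_lt d h).le
  refine core n (fun k => ((p k).1, fun i => ρ ((p k).2 i))) (fun k i => ?_) (fun a b hab hσ i => ?_) ?_
  · -- cycle-constant classes (symmetry: dominant terms are involutions with cycle-constant class maps)
    have hl := (isDominant_symm_involutive d v ε hv hεs (θ k) (p k).1 (p k).2 (hdom k)).2 i
    show ρ ((p k).2 ((p k).1 i)) = ρ ((p k).2 i)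
    rw [hl]
  · -- same permutation ⇒ entrywise non-decreasing exponents (column monotonicity)
    change (p a).1 = (p b).1 at hσ
    show ρ ((p a).2 i) ≤ ρ ((p b).2 i)
    by_cases h : (p a).2 i = (p b).2 i
    · rw [h]
    · have hpa : p a = ((p a).1, (p a).2) := rfl
      have hpb : p b = ((p a).1, (p b).2) := by rw [hσ]
      have hda : IsDominant d v ε (θ a) ((p a).1, (p a).2) := hpa ▸ hdom a
      have hdb : IsDominant d v ε (θ b) ((p a).1, (p b).2) := hpb ▸ hdom b
      exact hρle (d_lt_of_dominant d v ε (hθ hab) _ _ _ hda hdb i h)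
  · -- the rank multisets are pairwise distinct (slopes strictly increase; equal ranks have equal exponents)
    classical
    obtain ⟨g, hg⟩ : ∃ g : Fin 4 → ℕ, ∀ l, g (ρ l) = d l := by
      refine ⟨fun s => if h : ∃ l, ρ l = s then d h.choose else 0, fun l => ?_⟩
      have h : ∃ l', ρ l' = ρ l := ⟨l, rfl⟩
      dsimp only
      rw [dif_pos h]
      exact hρeq h.choose_spec
    have hslope : ∀ k, TropicalCensus.slope d (p k) = TropicalCensus.slope g ((p k).1, fun i => ρ ((p k).2 i)) := by
      intro k
      unfold TropicalCensus.slope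
      simp only [hg]
    have key : ∀ a b : Fin (n + 1), a < b →
        TropicalCensus.classSym ((p a).1, fun i => ρ ((p a).2 i)) ≠
          TropicalCensus.classSym ((p b).1, fun i => ρ ((p b).2 i)) := by
      intro a b hlt heq
      have h1 := slope_lt_of_dominant d v ε (hθ hlt) (fun e => (ne_of_lt hlt) (hinj e)) (hdom a) (hdom b)
      rw [hslope, hslope, slope_eq_of_classSym, slope_eq_of_classSym, heq] at h1
      exact lt_irrefl _ h1
    intro a b hab
    change TropicalCensus.classSym ((p a).1, fun i => ρ ((p a).2 i)) =
      TropicalCensus.classSym ((p b).1, fun i => ρ ((p b).2 i)) at hab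
    rcases lt_trichotomy a b with h | h | h
    · exact absurd hab (key a b h)
    · exact h
    · exact absurd hab.symm (key b a h)

end Summit.ValiantsHypothesis.ValiantsHypothesis.Theorems.KPlusLogSqLaw
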